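import Mathlib
import HarnessLib

/-!
# `NoHeavyLowerTail` (crux stmt-CriticalPhenomena-4575), antithetic vdBHK programme: the UNIFORM POTENTIAL TOWER — slot lemma at every depth

Support file (seat `prim-ineq-gen-7` gen 36; `--supports stmt-CriticalPhenomena-4575`).  Nothing is asserted about the crux; no `sorry`.
Memo: run/shared/lean/prim/prim-ineq-gen-7/FINDING-TOWER2-g36.md §3 and PROOF-TOWER2-g36.md §P3–§P4, continuing
FINDING-CAT-g35.md (BROOM REDUCTION, `AntitheticBroomReduction.reduction`) and FINDING-NECK1-g34.md (pair potentials).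

CONTEXT.  The BROOM REDUCTION of CONJECTURE HB needs, at every depth `k`, a potential `ψ_k` on the `2^k`-tuples of sibling copies of a top
with `ψ_k ≥ 0` and a base inequality.  Gen 36 found (closed form of the g34 least pair potential, then by a recursion) that per slot
(type, quadruple) the potentials are `ψ_k = LOC_k + θ_k` with
  `θ_k = [principal routes not full] · [principal copy closed] · E_k`,
  `E_k = [some non-principal copy is open, all copies of the smallest aligned sub-cube containing it and the principal copy being capable]`,
  `LOC_{k+1} = O_P (F0X − F0) + O_X (F0 − FX) − θ_k(upper; F0X) − θ_k(lower; F0) + θ_k(lower; FX)`  (`LOC_1 = W`, the neck excess),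
where a `2^{k+1}`-tuple is split into its LOWER and UPPER halves (newest leaf bit 0 / 1), `P` = principal copy (all bits 1), `X` = `P` with
the newest bit cleared, `O` = open, `F0, FX, F0X` = fullness of the principal route row, of the `X`-route row and of their union.
This file encodes tuples as complete binary trees of copies (`Tup k`, leaves carrying the capable/open bits), defines `E`, `θ`, `LOC` by the
recursion, and proves the SLOT LEMMA for every `k`:
  (i) `θ_{k+1} ≥ −LOC_{k+1}` (i.e. `ψ_{k+1} ≥ 0`) for all admissible fullness bits, and
  (ii) `θ_{k+1}` is the least value independent of `FX, F0X` with (i) and `≥ 0`: it is attained as `−LOC_{k+1}` for some admissible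
       `(FX, F0X)` unless it is `0`.
The proof is the ten-line case analysis of PROOF-TOWER2 §P4: one structural lemma (`E` under 'all capable' is 'some non-principal copy open')
and a finite Boolean verification (`step`).
-/

namespace Summit.CriticalPhenomena.PercolationContinuityZ3.Theorems

namespace AntitheticUniformPotential

/-- Tuples of sibling copies of a top as complete binary trees: a leaf is one copy with its (capable, open) bits; `node low upp` joins the
LOWER half (newest leaf bit 0) and the UPPER half (bit 1).  The principal copy is the right-most leaf. [this work] -/
inductive Tup : ℕ → Type
  | leaf : Bool → Bool → Tup 0
  | node : {k : ℕ} → Tup k → Tup k → Tup (k + 1)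

namespace Tup

/-- All copies capable. [this work] -/
def call : {k : ℕ} → Tup k → Bool
  | _, leaf c _ => c
  | _, node low upp => call low && call upp

/-- Some copy open. [this work] -/
def anyO : {k : ℕ} → Tup k → Bool
  | _, leaf _ o => o
  | _, node low upp => anyO low || anyO upp

/-- The principal copy (all bits 1) is open. [this work] -/
def oP : {k : ℕ} → Tup k → Bool
  | _, leaf _ o => o
  | _, node _ upp => oP upp

/-- Some NON-principal copy is open. [this work] -/
def anyONP : {k : ℕ} → Tup k → Bool
  | _, leaf _ _ => false
  | _, node low upp => anyO low || anyONP upp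

/-- The bracket `E_k` of the uniform potential: some non-principal copy `c` is open and every copy of the aligned sub-cube `Cube_{j(c)}`
(the copies agreeing with the principal one above the highest bit where `c` differs) is capable.  Recursively: such a `c` lies in the
upper half (then its cube lies in the upper half) or in the lower half (then its cube is everything). [this work] -/
def E : {k : ℕ} → Tup k → Bool
  | _, leaf _ _ => false
  | _, node low upp => E upp || (call (node low upp) && anyO low)

/-- `anyO = oP ∨ anyONP`. [this work] -/
theorem anyO_eq : ∀ {k : ℕ} (t : Tup k), t.anyO = (t.oP || t.anyONP)
  | _, leaf c o => by simp [anyO, oP, anyONP]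
  | _, node low upp => by
      simp only [anyO, oP, anyONP, anyO_eq upp]
      cases low.anyO <;> cases upp.oP <;> cases upp.anyONP <;> rfl

/-- Under 'all copies capable' the bracket `E` is 'some non-principal copy open'. [this work] -/
theorem E_of_call : ∀ {k : ℕ} (t : Tup k), t.call = true → t.E = t.anyONP
  | _, leaf c o, _ => by simp [E, anyONP]
  | _, node low upp, h => by
      have hc : low.call = true ∧ upp.call = true := by simpa [call, Bool.and_eq_true] using h
      simp only [E, anyONP, h, E_of_call upp hc.2, Bool.true_and]
      cases low.anyO <;> cases upp.anyONP <;> rfl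

end Tup

/-- `[b]` as an integer. [this work] -/
def bi (b : Bool) : ℤ := if b then 1 else 0

/-- The uniform potential `θ_k` of one slot: `[¬F0] · [principal closed] · E_k`. [this work] -/
def theta {k : ℕ} (t : Tup k) (F0 : Bool) : ℤ := bi (!F0 && !t.oP && t.E)

/-- `LOC_{k+1}` of one slot by the recursion of PROOF-TOWER2 §P3 (for `k+1 = 1` the two `θ_0` terms vanish and `LOC_1 = W`, the neck excess
`O_P (F0X − F0) + O_X (F0 − FX)`). [this work] -/
def loc {k : ℕ} : Tup (k + 1) → Bool → Bool → Bool → ℤ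
  | Tup.node low upp, F0, FX, F0X =>
      bi upp.oP * (bi F0X - bi F0) + bi low.oP * (bi F0 - bi FX) - theta upp F0X - theta low F0 + theta low FX

/-- `θ_0 = 0` (a single copy has no non-principal sibling), so `LOC_1` is the bare neck excess `W`. [this work] -/
theorem theta_leaf (c o F : Bool) : theta (Tup.leaf c o) F = 0 := by
  simp [theta, Tup.E, bi]

/-- The finite Boolean core of the slot lemma (PROOF-TOWER2 §P4): with `oPu, Eu` = open/bracket bits of the UPPER half (whose principal is the
principal copy), `oPl, El, anl` = open-principal / bracket / some-non-principal-open bits of the LOWER half, `cl, cu` = all-capable bits of the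
halves, and admissible fullness bits (`F0, FX ≤ F0X`; a full route row forces every copy to be capable; under all-capable the lower bracket is
'some non-principal lower copy open'):  the new `θ` dominates `−LOC` and is attained (least `FX`-independent choice). [this work] -/
theorem step :
    ∀ (oPu Eu oPl El anl cl cu F0 FX F0X : Bool),
      (F0 = true → F0X = true) → (FX = true → F0X = true) →
      (F0X = true → (cl && cu) = true) → (FX = true → (cl && cu) = true) →
      ((cl && cu) = true → El = anl) →
      -- θ_{k+1} = [¬F0 ∧ ¬oPu ∧ (Eu ∨ (all capable ∧ some lower copy open))],  LOC_{k+1} as in `loc`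
      let th := bi (!F0 && !oPu && (Eu || (cl && cu && (oPl || anl))))
      let lc := bi oPu * (bi F0X - bi F0) + bi oPl * (bi F0 - bi FX)
                  - bi (!F0X && !oPu && Eu) - bi (!F0 && !oPl && El) + bi (!FX && !oPl && El)
      th ≥ -lc ∧ 0 ≤ th ∧
        (th = 0 ∨ ∃ FX' F0X' : Bool, (F0 = true → F0X' = true) ∧ (FX' = true → F0X' = true) ∧
            (F0X' = true → (cl && cu) = true) ∧ (FX' = true → (cl && cu) = true) ∧
            th = -(bi oPu * (bi F0X' - bi F0) + bi oPl * (bi F0 - bi FX')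
                  - bi (!F0X' && !oPu && Eu) - bi (!F0 && !oPl && El) + bi (!FX' && !oPl && El))) := by
  decide

/-- **SLOT LEMMA, every depth** (FINDING-TOWER2-g36 §3c, PROOF-TOWER2 §P4).  For every `k`, every `2^{k+1}`-tuple `node low upp` of copies and all
admissible fullness bits: (i) `θ_{k+1} ≥ −LOC_{k+1}`, i.e. the potential `ψ_{k+1} = LOC_{k+1} + θ_{k+1}` is nonnegative; (ii) `θ_{k+1} ≥ 0`; and
(iii) `θ_{k+1}` is attained as `−LOC_{k+1}` for some admissible `(FX, F0X)` unless it vanishes — so it is the LEAST nonnegative value independent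
of `FX, F0X` satisfying (i) (that independence is forced by the level inequality, PROOF-TOWER2 §P4). [this work] -/
theorem slot_lemma {k : ℕ} (low upp : Tup k) (F0 FX F0X : Bool)
    (h0 : F0 = true → F0X = true) (hX : FX = true → F0X = true)
    (hC : F0X = true → (Tup.node low upp).call = true) (hCX : FX = true → (Tup.node low upp).call = true) :
    theta (Tup.node low upp) F0 ≥ -loc (Tup.node low upp) F0 FX F0X ∧ 0 ≤ theta (Tup.node low upp) F0 ∧
      (theta (Tup.node low upp) F0 = 0 ∨ ∃ FX' F0X' : Bool, (F0 = true → F0X' = true) ∧ (FX' = true → F0X' = true) ∧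
        (F0X' = true → (Tup.node low upp).call = true) ∧ (FX' = true → (Tup.node low upp).call = true) ∧
        theta (Tup.node low upp) F0 = -loc (Tup.node low upp) F0 FX' F0X') := by
  have hcall : (Tup.node low upp).call = (low.call && upp.call) := rfl
  have hEl : (low.call && upp.call) = true → low.E = low.anyONP := fun h => by
    have : low.call = true := by revert h; cases low.call <;> simp
    exact Tup.E_of_call low this
  have hs := step upp.oP upp.E low.oP low.E low.anyONP low.call upp.call F0 FX F0X h0 hX
    (by rw [← hcall]; exact hC) (by rw [← hcall]; exact hCX) hEl
  have hE : (Tup.node low upp).E = (upp.E || ((low.call && upp.call) && low.anyO)) := rfl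
  have hoP : (Tup.node low upp).oP = upp.oP := rfl
  simp only [theta, loc, hE, hoP, hcall, Tup.anyO_eq low] at hs ⊢
  -- normalise the Boolean bracket of `hs` to the one of the goal
  have hb : (upp.E || (low.call && upp.call && (low.oP || low.anyONP))) = (upp.E || ((low.call && upp.call) && (low.oP || low.anyONP))) := by
    cases upp.E <;> cases low.call <;> cases upp.call <;> cases low.oP <;> cases low.anyONP <;> rfl
  rw [hb] at hs
  exact hs

/-- The depth-1 instance in words (FINDING-TOWER2 §1d): for a sibling PAIR (`k+1 = 1`, lower = copy 2 = `X`, upper = copy 1 = principal) the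
potential is `θ* = [¬F(k¹)] [copy 1 closed] [copy 2 open] [both capable]` and `ψ* = W + θ* ≥ 0` — the closed form of the g34 least pair potential
(there a 25,014-entry table). [this work] -/
theorem pair_potential_nonneg (c1 o1 c2 o2 F0 FX F0X : Bool)
    (h0 : F0 = true → F0X = true) (hX : FX = true → F0X = true)
    (hC : F0X = true → (c2 && c1) = true) (hCX : FX = true → (c2 && c1) = true) :
    theta (Tup.node (Tup.leaf c2 o2) (Tup.leaf c1 o1)) F0
        + loc (Tup.node (Tup.leaf c2 o2) (Tup.leaf c1 o1)) F0 FX F0X ≥ 0 := by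
  have h := (slot_lemma (Tup.leaf c2 o2) (Tup.leaf c1 o1) F0 FX F0X h0 hX hC hCX).1
  linarith

end AntitheticUniformPotential

end Summit.CriticalPhenomena.PercolationContinuityZ3.Theorems
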